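import Summits.Ventures.YMGap.Thresholds.OneLinkRecentredRemainder
import Summits.Ventures.YMGap.Thresholds.OneLinkRemainderPrimeL2
import HarnessLib

/-!
# Venture YMGap — the one-link modulus beyond first order, part 60: the RECENTRED cubic remainder in `L²(ν_B)` — the affine majorant and
# `√(∫ Γ(ĉ₃′,ĉ₃′) dν_B) ≤ â + b̂₁ Ẑ₁ + b̂₂ Ẑ₂ + b₃ W_ΔB + b₄ W_BB` with the FLUCTUATION scales `Ẑ_j = √∫‖z_j − m_j‖²`
# (fifth foundation file of the mean-field recentring lever, `HOME/p2/ONE-LINK-HIERARCHY.md` §16 (α), `HOME/p2/hier/LEAN-SPEC-RECENTRING.md` F3)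

HONEST FRAMING: venture file of the cell `pub-ymgap` (QuantumFields programme), strong-coupling LATTICE bookkeeping for `SU(N)`
lattice Yang–Mills; nothing about the continuum or the mass gap in the Clay sense.  No number of record.  This is the tree's
`OneLinkRemainderPrimeL2` for the recentred remainder `ĉ₃′` of `OneLinkRecentredRemainder.Gam_c3hat_le` (arbitrary complex `m₁, m₂`):
* `contDiff_c3hat`; `c3hatbound_le_affine`: the pointwise majorant `P̂′` is affine in `‖tr(gB) − m₁‖`, `‖tr(gΔ) − m₂‖`, `‖tr(gΔgB)‖`,
  `‖tr(gBgB)‖` (the un-recentred factors of the `X·Im t` term are bounded pointwise by `‖tr(gM)‖ ≤ √N‖M‖_F`, and `‖tr(gΔ)‖ ≤ ‖tr(gΔ) − m₂‖ + ‖m₂‖`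
  moves the last one into the constant: `â = 3κ_w r²‖Δ‖_F + (2κ_t/N)√N‖B‖_F²‖m₂‖`);
* ★ `sqrt_integral_Gam_c3hat_le`: `√(∫ Γ(ĉ₃′,ĉ₃′) dν_B) ≤ â + b̂₁ Ẑ₁ + b̂₂ Ẑ₂ + b₃ W_ΔB + b₄ W_BB`,
  `b̂₁ = ‖Δ‖_F r (4κ_w/N + κ_t + c) + (4κ_t/N)√N‖B‖_F‖Δ‖_F`, `b̂₂ = (κ_t + c) r ‖B‖_F + (2κ_t/N)√N‖B‖_F²`, `b₃, b₄` as in the tree.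
  With `m_j := ∫ z_j dν_B` the `Ẑ_j` are standard deviations: `Ẑ_j ≤ ‖M_j‖_F/√(N(½ − r))` (Bakry–Émery, `OneLinkFluctuations`) — N-UNIFORM at
  `‖B‖_F ≤ √N r`, against the `Z`-scale `N ω̃(N,r)` of the un-recentred assembly.
References: cell notes above.
-/

noncomputable section

open scoped Matrix ComplexConjugate BigOperators ContDiff Matrix.Norms.Frobenius
open Matrix Complex Finset MeasureTheory ProbabilityTheory
open Literature.MathematicalPhysics.QuantumFieldTheory
open Literature.MathematicalPhysics.QuantumFieldTheory.SUNBakryEmery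

namespace Summit.Ventures.YMGap.OneLinkEigen

variable {N : ℕ}

/-- The recentred five-term polynomial `ĉ₃'` is smooth. [folklore] -/
theorem contDiff_c3hat (N : ℕ) (B Δ : Matrix (Fin N) (Fin N) ℂ) (m₁ m₂ : ℂ) :
    ContDiff ℝ ∞ (fun Q : Matrix (Fin N) (Fin N) ℂ =>
      ((N : ℝ) ^ 2 / (4 * ((N : ℝ) ^ 2 - 4))) / 2 *
          ((Q * B * Q * Δ * Q * B).trace.re + (Q * B * Q * B * Q * Δ).trace.re)
        + 2 * ((N : ℝ) ^ 2 / (4 * ((N : ℝ) ^ 2 - 4))) / N * ((Q * B).trace - m₁).im * (Q * Δ * Q * B).trace.im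
        - 1 / 2 * ((Q * B * Q * B).trace *
            ((((N : ℝ) / (2 * ((N : ℝ) ^ 2 - 4)) : ℝ) : ℂ) * ((Q * Δ).trace - m₂)
              - ((1 / (4 * (N : ℝ)) : ℝ) : ℂ) * (starRingEnd ℂ) ((Q * Δ).trace - m₂))).re
        - 1 / 2 * ((Q * Δ * Q * B).trace *
            ((((N : ℝ) / (2 * ((N : ℝ) ^ 2 - 4)) : ℝ) : ℂ) * ((Q * B).trace - m₁)
              - ((1 / (4 * (N : ℝ)) : ℝ) : ℂ) * (starRingEnd ℂ) ((Q * B).trace - m₁))).re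
        - 2 * ((N : ℝ) / (2 * ((N : ℝ) ^ 2 - 4))) / N *
          ((Q * B).trace - m₁).im * ((Q * B).trace * (Q * Δ).trace).im) := by
  have hG : (fun Q : Matrix (Fin N) (Fin N) ℂ =>
      ((N : ℝ) ^ 2 / (4 * ((N : ℝ) ^ 2 - 4))) / 2 *
          ((Q * B * Q * Δ * Q * B).trace.re + (Q * B * Q * B * Q * Δ).trace.re)
        + 2 * ((N : ℝ) ^ 2 / (4 * ((N : ℝ) ^ 2 - 4))) / N * ((Q * B).trace - m₁).im * (Q * Δ * Q * B).trace.im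
        - 1 / 2 * ((Q * B * Q * B).trace *
            ((((N : ℝ) / (2 * ((N : ℝ) ^ 2 - 4)) : ℝ) : ℂ) * ((Q * Δ).trace - m₂)
              - ((1 / (4 * (N : ℝ)) : ℝ) : ℂ) * (starRingEnd ℂ) ((Q * Δ).trace - m₂))).re
        - 1 / 2 * ((Q * Δ * Q * B).trace *
            ((((N : ℝ) / (2 * ((N : ℝ) ^ 2 - 4)) : ℝ) : ℂ) * ((Q * B).trace - m₁)
              - ((1 / (4 * (N : ℝ)) : ℝ) : ℂ) * (starRingEnd ℂ) ((Q * B).trace - m₁))).re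
        - 2 * ((N : ℝ) / (2 * ((N : ℝ) ^ 2 - 4))) / N *
          ((Q * B).trace - m₁).im * ((Q * B).trace * (Q * Δ).trace).im) =
      fun Q : Matrix (Fin N) (Fin N) ℂ =>
        (((N : ℝ) ^ 2 / (4 * ((N : ℝ) ^ 2 - 4))) / 2) * ((Q * B * Q * Δ * Q * B).trace.re + (Q * B * Q * B * Q * Δ).trace.re)
        + (2 * ((N : ℝ) ^ 2 / (4 * ((N : ℝ) ^ 2 - 4))) / N) * (((Q * B).trace - m₁).im * (Q * Δ * Q * B).trace.im)
        + (-(1 / 2)) * ((Q * B * Q * B).trace * ((((N : ℝ) / (2 * ((N : ℝ) ^ 2 - 4)) : ℝ) : ℂ) * ((Q * Δ).trace - m₂)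
            - ((1 / (4 * (N : ℝ)) : ℝ) : ℂ) * (starRingEnd ℂ) ((Q * Δ).trace - m₂))).re
        + (-(1 / 2)) * ((Q * Δ * Q * B).trace * ((((N : ℝ) / (2 * ((N : ℝ) ^ 2 - 4)) : ℝ) : ℂ) * ((Q * B).trace - m₁)
            - ((1 / (4 * (N : ℝ)) : ℝ) : ℂ) * (starRingEnd ℂ) ((Q * B).trace - m₁))).re
        + (-(2 * ((N : ℝ) / (2 * ((N : ℝ) ^ 2 - 4))) / N)) * (((Q * B).trace - m₁).im * ((Q * B).trace * (Q * Δ).trace).im) := by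
    funext Q; ring
  rw [hG]
  have h1 := (contDiff_reTrCubic (N := N) B Δ B).add (contDiff_reTrCubic (N := N) B B Δ)
  have h3 := (contDiff_imTrMul_sub (N := N) B m₁).mul (contDiff_imTrQuad (N := N) Δ B)
  have h4 := contDiff_quad_etaShift (N := N) ((N : ℝ) / (2 * ((N : ℝ) ^ 2 - 4))) (1 / (4 * (N : ℝ))) B B Δ m₂
  have h5 := contDiff_quad_etaShift (N := N) ((N : ℝ) / (2 * ((N : ℝ) ^ 2 - 4))) (1 / (4 * (N : ℝ))) Δ B B m₁
  have h8 := contDiff_imShift_mul_imProd (N := N) B Δ m₁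
  exact ((((contDiff_const.mul h1).add (contDiff_const.mul h3)).add (contDiff_const.mul h4)).add (contDiff_const.mul h5)).add
    (contDiff_const.mul h8)

/-- **The pointwise majorant `P̂′` of the recentred remainder, affine in `‖tr(gB) − m₁‖, ‖tr(gΔ) − m₂‖, ‖tr(gΔgB)‖, ‖tr(gBgB)‖`**
(`|Im(z − m)| ≤ ‖z − m‖`, `‖tr(gM)‖ ≤ √N‖M‖_F`, `‖tr(gΔ)‖ ≤ ‖tr(gΔ) − m₂‖ + ‖m₂‖`). [folklore] -/
theorem c3hatbound_le_affine (hN : 3 ≤ N) (B Δ : Matrix (Fin N) (Fin N) ℂ) (m₁ m₂ : ℂ) (g : SUN N) :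
    (3 * ((N : ℝ) ^ 2 / (4 * ((N : ℝ) ^ 2 - 4))) * matrixOpNorm B ^ 2 * frobNorm Δ
        + 2 * ((N : ℝ) ^ 2 / (4 * ((N : ℝ) ^ 2 - 4))) / N *
          (2 * matrixOpNorm B * frobNorm Δ * |(((g : Matrix (Fin N) (Fin N) ℂ) * B).trace - m₁).im|
            + frobNorm B * ‖((g : Matrix (Fin N) (Fin N) ℂ) * Δ * g * B).trace‖)
        + 1 / 2 * (((N : ℝ) / (2 * ((N : ℝ) ^ 2 - 4))) + 1 / (4 * (N : ℝ))) *
          (2 * matrixOpNorm B * frobNorm B * ‖((g : Matrix (Fin N) (Fin N) ℂ) * Δ).trace - m₂‖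
            + frobNorm Δ * ‖((g : Matrix (Fin N) (Fin N) ℂ) * B * g * B).trace‖)
        + 1 / 2 * (((N : ℝ) / (2 * ((N : ℝ) ^ 2 - 4))) + 1 / (4 * (N : ℝ))) *
          (2 * matrixOpNorm B * frobNorm Δ * ‖((g : Matrix (Fin N) (Fin N) ℂ) * B).trace - m₁‖
            + frobNorm B * ‖((g : Matrix (Fin N) (Fin N) ℂ) * Δ * g * B).trace‖)
        + 2 * ((N : ℝ) / (2 * ((N : ℝ) ^ 2 - 4))) / N *
          (frobNorm B * |(((g : Matrix (Fin N) (Fin N) ℂ) * B).trace - m₁).im| * ‖((g : Matrix (Fin N) (Fin N) ℂ) * Δ).trace‖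
            + frobNorm Δ * |(((g : Matrix (Fin N) (Fin N) ℂ) * B).trace - m₁).im| * ‖((g : Matrix (Fin N) (Fin N) ℂ) * B).trace‖
            + frobNorm B * ‖((g : Matrix (Fin N) (Fin N) ℂ) * B).trace‖ * ‖((g : Matrix (Fin N) (Fin N) ℂ) * Δ).trace‖)) ≤
      (3 * ((N : ℝ) ^ 2 / (4 * ((N : ℝ) ^ 2 - 4))) * matrixOpNorm B ^ 2 * frobNorm Δ + 2 * ((N : ℝ) / (2 * ((N : ℝ) ^ 2 - 4))) / N * Real.sqrt N * frobNorm B * frobNorm B * ‖m₂‖)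
        + (frobNorm Δ * matrixOpNorm B * (4 * ((N : ℝ) ^ 2 / (4 * ((N : ℝ) ^ 2 - 4))) / N + (((N : ℝ) / (2 * ((N : ℝ) ^ 2 - 4))) + 1 / (4 * (N : ℝ)))) + 4 * ((N : ℝ) / (2 * ((N : ℝ) ^ 2 - 4))) / N * Real.sqrt N * frobNorm B * frobNorm Δ) * ‖((g : Matrix (Fin N) (Fin N) ℂ) * B).trace - m₁‖
        + ((((N : ℝ) / (2 * ((N : ℝ) ^ 2 - 4))) + 1 / (4 * (N : ℝ))) * matrixOpNorm B * frobNorm B + 2 * ((N : ℝ) / (2 * ((N : ℝ) ^ 2 - 4))) / N * Real.sqrt N * frobNorm B * frobNorm B) * ‖((g : Matrix (Fin N) (Fin N) ℂ) * Δ).trace - m₂‖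
        + (frobNorm B * (2 * ((N : ℝ) ^ 2 / (4 * ((N : ℝ) ^ 2 - 4))) / N + 1 / 2 * (((N : ℝ) / (2 * ((N : ℝ) ^ 2 - 4))) + 1 / (4 * (N : ℝ))))) * ‖((g : Matrix (Fin N) (Fin N) ℂ) * Δ * g * B).trace‖
        + (frobNorm Δ * (1 / 2 * (((N : ℝ) / (2 * ((N : ℝ) ^ 2 - 4))) + 1 / (4 * (N : ℝ))))) * ‖((g : Matrix (Fin N) (Fin N) ℂ) * B * g * B).trace‖ := by
  have hN0 : N ≠ 0 := by omega
  have h3 : (3 : ℝ) ≤ N := by exact_mod_cast hN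
  have hN4 : (0 : ℝ) < (N : ℝ) ^ 2 - 4 := by nlinarith
  have hNpos : (0 : ℝ) < N := by linarith
  have hsN : 0 < Real.sqrt N := Real.sqrt_pos.2 hNpos
  set κw : ℝ := (N : ℝ) ^ 2 / (4 * ((N : ℝ) ^ 2 - 4)) with hκw
  set κt : ℝ := (N : ℝ) / (2 * ((N : ℝ) ^ 2 - 4)) with hκt
  have hκw0 : 0 ≤ κw := by positivity
  have hκt0 : 0 ≤ κt := by positivity
  set Q : Matrix (Fin N) (Fin N) ℂ := (g : Matrix (Fin N) (Fin N) ℂ) with hQ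
  set r := matrixOpNorm B with hr
  set nB := frobNorm B with hnB
  set nD := frobNorm Δ with hnD
  set z1 := ‖(Q * B).trace‖ with hz1
  set z2 := ‖(Q * Δ).trace‖ with hz2
  set y1 := ‖(Q * B).trace - m₁‖ with hy1
  set y2 := ‖(Q * Δ).trace - m₂‖ with hy2
  set X := |((Q * B).trace - m₁).im| with hX
  set w := ‖(Q * Δ * Q * B).trace‖ with hw
  set wBB := ‖(Q * B * Q * B).trace‖ with hwBB
  set S := Real.sqrt N with hS
  have hr0 : 0 ≤ r := matrixOpNorm_nonneg B
  have hnB0 : 0 ≤ nB := frobNorm_nonneg B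
  have hnD0 : 0 ≤ nD := frobNorm_nonneg Δ
  have hz10 : 0 ≤ z1 := norm_nonneg _
  have hz20 : 0 ≤ z2 := norm_nonneg _
  have hy10 : 0 ≤ y1 := norm_nonneg _
  have hy20 : 0 ≤ y2 := norm_nonneg _
  have hX0 : 0 ≤ X := abs_nonneg _
  have hw0 : 0 ≤ w := norm_nonneg _
  have hwBB0 : 0 ≤ wBB := norm_nonneg _
  have hm2 : 0 ≤ ‖m₂‖ := norm_nonneg _
  have bX1 : X ≤ y1 := abs_im_le_norm' _
  have bz1 : z1 ≤ S * nB := by rw [hz1, hQ]; exact norm_trace_su_mul_le B g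
  have bz2 : z2 ≤ S * nD := by rw [hz2, hQ]; exact norm_trace_su_mul_le Δ g
  have bz2' : z2 ≤ y2 + ‖m₂‖ := by
    rw [hz2, hy2]
    have e : (Q * Δ).trace = ((Q * Δ).trace - m₂) + m₂ := by ring
    calc ‖(Q * Δ).trace‖ = ‖((Q * Δ).trace - m₂) + m₂‖ := by rw [← e]
      _ ≤ ‖(Q * Δ).trace - m₂‖ + ‖m₂‖ := norm_add_le _ _
  have p1 : 2 * r * nD * X ≤ 2 * r * nD * y1 := mul_le_mul_of_nonneg_left bX1 (by positivity)
  have p4 : nB * X * z2 ≤ nB * y1 * (S * nD) := mul_le_mul (mul_le_mul_of_nonneg_left bX1 hnB0) bz2 hz20 (by positivity)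
  have p5 : nD * X * z1 ≤ nD * y1 * (S * nB) := mul_le_mul (mul_le_mul_of_nonneg_left bX1 hnD0) bz1 hz10 (by positivity)
  have p6 : nB * z1 * z2 ≤ nB * (S * nB) * (y2 + ‖m₂‖) :=
    mul_le_mul (mul_le_mul_of_nonneg_left bz1 hnB0) bz2' hz20 (by positivity)
  have hκ1 : 0 ≤ κt + 1 / (4 * (N : ℝ)) := by positivity
  have q1 := mul_le_mul_of_nonneg_left p1 (by positivity : (0 : ℝ) ≤ 2 * κw / N)
  have q4 := mul_le_mul_of_nonneg_left p4 (by positivity : (0 : ℝ) ≤ 2 * κt / N)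
  have q5 := mul_le_mul_of_nonneg_left p5 (by positivity : (0 : ℝ) ≤ 2 * κt / N)
  have q6 := mul_le_mul_of_nonneg_left p6 (by positivity : (0 : ℝ) ≤ 2 * κt / N)
  simp only [div_eq_mul_inv] at q1 q4 q5 q6 ⊢
  linarith [q1, q4, q5, q6]

/-- **The `L²(ν_B)` gradient norm of the recentred remainder `ĉ₃′`** with the fluctuation scales `Ẑ_j = √∫‖z_j − m_j‖²` and the
quadratic words in `L²`: `√(∫ Γ(ĉ₃′,ĉ₃′) dν_B) ≤ â + b̂₁ Ẑ₁ + b̂₂ Ẑ₂ + b₃ W_ΔB + b₄ W_BB` (`N ≥ 3`). [folklore] -/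
theorem sqrt_integral_Gam_c3hat_le (hN : 3 ≤ N) (B Δ : Matrix (Fin N) (Fin N) ℂ) (m₁ m₂ : ℂ) :
    Real.sqrt (∫ g, Gam (fun Q : Matrix (Fin N) (Fin N) ℂ =>
      ((N : ℝ) ^ 2 / (4 * ((N : ℝ) ^ 2 - 4))) / 2 *
          ((Q * B * Q * Δ * Q * B).trace.re + (Q * B * Q * B * Q * Δ).trace.re)
        + 2 * ((N : ℝ) ^ 2 / (4 * ((N : ℝ) ^ 2 - 4))) / N * ((Q * B).trace - m₁).im * (Q * Δ * Q * B).trace.im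
        - 1 / 2 * ((Q * B * Q * B).trace *
            ((((N : ℝ) / (2 * ((N : ℝ) ^ 2 - 4)) : ℝ) : ℂ) * ((Q * Δ).trace - m₂)
              - ((1 / (4 * (N : ℝ)) : ℝ) : ℂ) * (starRingEnd ℂ) ((Q * Δ).trace - m₂))).re
        - 1 / 2 * ((Q * Δ * Q * B).trace *
            ((((N : ℝ) / (2 * ((N : ℝ) ^ 2 - 4)) : ℝ) : ℂ) * ((Q * B).trace - m₁)
              - ((1 / (4 * (N : ℝ)) : ℝ) : ℂ) * (starRingEnd ℂ) ((Q * B).trace - m₁))).re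
        - 2 * ((N : ℝ) / (2 * ((N : ℝ) ^ 2 - 4))) / N *
          ((Q * B).trace - m₁).im * ((Q * B).trace * (Q * Δ).trace).im)
        (fun Q : Matrix (Fin N) (Fin N) ℂ =>
      ((N : ℝ) ^ 2 / (4 * ((N : ℝ) ^ 2 - 4))) / 2 *
          ((Q * B * Q * Δ * Q * B).trace.re + (Q * B * Q * B * Q * Δ).trace.re)
        + 2 * ((N : ℝ) ^ 2 / (4 * ((N : ℝ) ^ 2 - 4))) / N * ((Q * B).trace - m₁).im * (Q * Δ * Q * B).trace.im
        - 1 / 2 * ((Q * B * Q * B).trace *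
            ((((N : ℝ) / (2 * ((N : ℝ) ^ 2 - 4)) : ℝ) : ℂ) * ((Q * Δ).trace - m₂)
              - ((1 / (4 * (N : ℝ)) : ℝ) : ℂ) * (starRingEnd ℂ) ((Q * Δ).trace - m₂))).re
        - 1 / 2 * ((Q * Δ * Q * B).trace *
            ((((N : ℝ) / (2 * ((N : ℝ) ^ 2 - 4)) : ℝ) : ℂ) * ((Q * B).trace - m₁)
              - ((1 / (4 * (N : ℝ)) : ℝ) : ℂ) * (starRingEnd ℂ) ((Q * B).trace - m₁))).re
        - 2 * ((N : ℝ) / (2 * ((N : ℝ) ^ 2 - 4))) / N *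
          ((Q * B).trace - m₁).im * ((Q * B).trace * (Q * Δ).trace).im) g
        ∂(haarProbability (SUN N)).tilted (fun g => (N : ℝ) * ((g : Matrix (Fin N) (Fin N) ℂ) * B).trace.re)) ≤
      (3 * ((N : ℝ) ^ 2 / (4 * ((N : ℝ) ^ 2 - 4))) * matrixOpNorm B ^ 2 * frobNorm Δ + 2 * ((N : ℝ) / (2 * ((N : ℝ) ^ 2 - 4))) / N * Real.sqrt N * frobNorm B * frobNorm B * ‖m₂‖)
        + (frobNorm Δ * matrixOpNorm B * (4 * ((N : ℝ) ^ 2 / (4 * ((N : ℝ) ^ 2 - 4))) / N + (((N : ℝ) / (2 * ((N : ℝ) ^ 2 - 4))) + 1 / (4 * (N : ℝ)))) + 4 * ((N : ℝ) / (2 * ((N : ℝ) ^ 2 - 4))) / N * Real.sqrt N * frobNorm B * frobNorm Δ) *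
          Real.sqrt (∫ g, ‖((g : Matrix (Fin N) (Fin N) ℂ) * B).trace - m₁‖ ^ 2 ∂(haarProbability (SUN N)).tilted (fun g => (N : ℝ) * ((g : Matrix (Fin N) (Fin N) ℂ) * B).trace.re))
        + ((((N : ℝ) / (2 * ((N : ℝ) ^ 2 - 4))) + 1 / (4 * (N : ℝ))) * matrixOpNorm B * frobNorm B + 2 * ((N : ℝ) / (2 * ((N : ℝ) ^ 2 - 4))) / N * Real.sqrt N * frobNorm B * frobNorm B) *
          Real.sqrt (∫ g, ‖((g : Matrix (Fin N) (Fin N) ℂ) * Δ).trace - m₂‖ ^ 2 ∂(haarProbability (SUN N)).tilted (fun g => (N : ℝ) * ((g : Matrix (Fin N) (Fin N) ℂ) * B).trace.re))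
        + (frobNorm B * (2 * ((N : ℝ) ^ 2 / (4 * ((N : ℝ) ^ 2 - 4))) / N + 1 / 2 * (((N : ℝ) / (2 * ((N : ℝ) ^ 2 - 4))) + 1 / (4 * (N : ℝ))))) *
          Real.sqrt (∫ g, ‖((g : Matrix (Fin N) (Fin N) ℂ) * Δ * g * B).trace‖ ^ 2 ∂(haarProbability (SUN N)).tilted (fun g => (N : ℝ) * ((g : Matrix (Fin N) (Fin N) ℂ) * B).trace.re))
        + (frobNorm Δ * (1 / 2 * (((N : ℝ) / (2 * ((N : ℝ) ^ 2 - 4))) + 1 / (4 * (N : ℝ))))) *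
          Real.sqrt (∫ g, ‖((g : Matrix (Fin N) (Fin N) ℂ) * B * g * B).trace‖ ^ 2 ∂(haarProbability (SUN N)).tilted (fun g => (N : ℝ) * ((g : Matrix (Fin N) (Fin N) ℂ) * B).trace.re)) := by
  have hN0 : N ≠ 0 := by omega
  have h3 : (3 : ℝ) ≤ N := by exact_mod_cast hN
  have hN4 : (0 : ℝ) < (N : ℝ) ^ 2 - 4 := by nlinarith
  have hNpos : (0 : ℝ) < N := by linarith
  set ν : Measure (SUN N) := (haarProbability (SUN N)).tilted (fun g => (N : ℝ) * ((g : Matrix (Fin N) (Fin N) ℂ) * B).trace.re) with hν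
  have hexpi : Integrable (fun g : SUN N => Real.exp ((N : ℝ) * ((g : Matrix (Fin N) (Fin N) ℂ) * B).trace.re))
      (haarProbability (SUN N)) :=
    integrable_of_continuous_SUN (Real.continuous_exp.comp (continuous_restrict (contDiff_pot (N : ℝ) B))) _
  haveI : IsProbabilityMeasure ν := isProbabilityMeasure_tilted hexpi
  have hc3 := contDiff_c3hat N B Δ m₁ m₂
  have hB0 := matrixOpNorm_nonneg B
  have hBF := frobNorm_nonneg B
  have hΔ := frobNorm_nonneg Δ
  have hm2 := norm_nonneg m₂
  have hκw0 : 0 ≤ ((N : ℝ) ^ 2 / (4 * ((N : ℝ) ^ 2 - 4))) := by positivity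
  have hκt0 : 0 ≤ ((N : ℝ) / (2 * ((N : ℝ) ^ 2 - 4))) := by positivity
  obtain ⟨a, ha⟩ : ∃ a : ℝ, a = (3 * ((N : ℝ) ^ 2 / (4 * ((N : ℝ) ^ 2 - 4))) * matrixOpNorm B ^ 2 * frobNorm Δ + 2 * ((N : ℝ) / (2 * ((N : ℝ) ^ 2 - 4))) / N * Real.sqrt N * frobNorm B * frobNorm B * ‖m₂‖) := ⟨_, rfl⟩
  obtain ⟨b₁, hb₁⟩ : ∃ b₁ : ℝ, b₁ = (frobNorm Δ * matrixOpNorm B * (4 * ((N : ℝ) ^ 2 / (4 * ((N : ℝ) ^ 2 - 4))) / N + (((N : ℝ) / (2 * ((N : ℝ) ^ 2 - 4))) + 1 / (4 * (N : ℝ)))) + 4 * ((N : ℝ) / (2 * ((N : ℝ) ^ 2 - 4))) / N * Real.sqrt N * frobNorm B * frobNorm Δ) := ⟨_, rfl⟩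
  obtain ⟨b₂, hb₂⟩ : ∃ b₂ : ℝ, b₂ = ((((N : ℝ) / (2 * ((N : ℝ) ^ 2 - 4))) + 1 / (4 * (N : ℝ))) * matrixOpNorm B * frobNorm B + 2 * ((N : ℝ) / (2 * ((N : ℝ) ^ 2 - 4))) / N * Real.sqrt N * frobNorm B * frobNorm B) := ⟨_, rfl⟩
  obtain ⟨b₃, hb₃⟩ : ∃ b₃ : ℝ, b₃ = (frobNorm B * (2 * ((N : ℝ) ^ 2 / (4 * ((N : ℝ) ^ 2 - 4))) / N + 1 / 2 * (((N : ℝ) / (2 * ((N : ℝ) ^ 2 - 4))) + 1 / (4 * (N : ℝ))))) := ⟨_, rfl⟩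
  obtain ⟨b₄, hb₄⟩ : ∃ b₄ : ℝ, b₄ = (frobNorm Δ * (1 / 2 * (((N : ℝ) / (2 * ((N : ℝ) ^ 2 - 4))) + 1 / (4 * (N : ℝ))))) := ⟨_, rfl⟩
  have ha0 : 0 ≤ a := by rw [ha]; positivity
  have hb₁0 : 0 ≤ b₁ := by rw [hb₁]; positivity
  have hb₂0 : 0 ≤ b₂ := by rw [hb₂]; positivity
  have hb₃0 : 0 ≤ b₃ := by rw [hb₃]; positivity
  have hb₄0 : 0 ≤ b₄ := by rw [hb₄]; positivity
  rw [← ha, ← hb₁, ← hb₂, ← hb₃, ← hb₄]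
  set fb : SUN N → ℝ := fun g => b₁ * ‖((g : Matrix (Fin N) (Fin N) ℂ) * B).trace - m₁‖ with hfb
  set fc : SUN N → ℝ := fun g => b₂ * ‖((g : Matrix (Fin N) (Fin N) ℂ) * Δ).trace - m₂‖ with hfc
  set fd : SUN N → ℝ := fun g => b₃ * ‖((g : Matrix (Fin N) (Fin N) ℂ) * Δ * (g : Matrix (Fin N) (Fin N) ℂ) * B).trace‖ with hfd
  set fe : SUN N → ℝ := fun g => b₄ * ‖((g : Matrix (Fin N) (Fin N) ℂ) * B * (g : Matrix (Fin N) (Fin N) ℂ) * B).trace‖ with hfe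
  have cG : Continuous fun g : SUN N => (g : Matrix (Fin N) (Fin N) ℂ) := continuous_subtype_val
  have htr : ∀ M : Matrix (Fin N) (Fin N) ℂ, Continuous fun g : SUN N => ((g : Matrix (Fin N) (Fin N) ℂ) * M).trace :=
    fun M => (cG.matrix_mul continuous_const).matrix_trace
  have hquad : ∀ M₁ M₂ : Matrix (Fin N) (Fin N) ℂ,
      Continuous fun g : SUN N => ((g : Matrix (Fin N) (Fin N) ℂ) * M₁ * (g : Matrix (Fin N) (Fin N) ℂ) * M₂).trace :=
    fun M₁ M₂ => (((cG.matrix_mul continuous_const).matrix_mul cG).matrix_mul continuous_const).matrix_trace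
  have hfbc : Continuous fb := continuous_const.mul (continuous_norm.comp ((htr B).sub continuous_const))
  have hfcc : Continuous fc := continuous_const.mul (continuous_norm.comp ((htr Δ).sub continuous_const))
  have hfdc : Continuous fd := continuous_const.mul (continuous_norm.comp (hquad Δ B))
  have hfec : Continuous fe := continuous_const.mul (continuous_norm.comp (hquad B B))
  have key := sqrt_integral_le_of_le_add_sq_four (a := a) (continuous_restrict (contDiff_Gam hc3 hc3)) hfbc hfcc hfdc hfec ha0
    (fun g => ?_) ν
  · have esq : ∀ (β : ℝ) (f : SUN N → ℝ), 0 ≤ β →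
        Real.sqrt (∫ x, (β * f x) ^ 2 ∂ν) = β * Real.sqrt (∫ x, f x ^ 2 ∂ν) := by
      intro β f hβ
      have : (fun x => (β * f x) ^ 2) = fun x => β ^ 2 * f x ^ 2 := by funext x; ring
      rw [this, integral_const_mul, Real.sqrt_mul (sq_nonneg _), Real.sqrt_sq hβ]
    have eb := esq b₁ (fun g => ‖((g : Matrix (Fin N) (Fin N) ℂ) * B).trace - m₁‖) hb₁0
    have ec := esq b₂ (fun g => ‖((g : Matrix (Fin N) (Fin N) ℂ) * Δ).trace - m₂‖) hb₂0
    have ed := esq b₃ (fun g => ‖((g : Matrix (Fin N) (Fin N) ℂ) * Δ * (g : Matrix (Fin N) (Fin N) ℂ) * B).trace‖) hb₃0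
    have ee := esq b₄ (fun g => ‖((g : Matrix (Fin N) (Fin N) ℂ) * B * (g : Matrix (Fin N) (Fin N) ℂ) * B).trace‖) hb₄0
    simp only [hfb, hfc, hfd, hfe] at key
    rw [eb, ec, ed, ee] at key
    exact key
  · have hP := Gam_c3hat_le hN B Δ m₁ m₂ g
    have haff := c3hatbound_le_affine hN B Δ m₁ m₂ g
    have hP0 : 0 ≤ (3 * ((N : ℝ) ^ 2 / (4 * ((N : ℝ) ^ 2 - 4))) * matrixOpNorm B ^ 2 * frobNorm Δ
          + 2 * ((N : ℝ) ^ 2 / (4 * ((N : ℝ) ^ 2 - 4))) / N *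
            (2 * matrixOpNorm B * frobNorm Δ * |(((g : Matrix (Fin N) (Fin N) ℂ) * B).trace - m₁).im|
              + frobNorm B * ‖((g : Matrix (Fin N) (Fin N) ℂ) * Δ * g * B).trace‖)
          + 1 / 2 * (((N : ℝ) / (2 * ((N : ℝ) ^ 2 - 4))) + 1 / (4 * (N : ℝ))) *
            (2 * matrixOpNorm B * frobNorm B * ‖((g : Matrix (Fin N) (Fin N) ℂ) * Δ).trace - m₂‖
              + frobNorm Δ * ‖((g : Matrix (Fin N) (Fin N) ℂ) * B * g * B).trace‖)
          + 1 / 2 * (((N : ℝ) / (2 * ((N : ℝ) ^ 2 - 4))) + 1 / (4 * (N : ℝ))) *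
            (2 * matrixOpNorm B * frobNorm Δ * ‖((g : Matrix (Fin N) (Fin N) ℂ) * B).trace - m₁‖
              + frobNorm B * ‖((g : Matrix (Fin N) (Fin N) ℂ) * Δ * g * B).trace‖)
          + 2 * ((N : ℝ) / (2 * ((N : ℝ) ^ 2 - 4))) / N *
            (frobNorm B * |(((g : Matrix (Fin N) (Fin N) ℂ) * B).trace - m₁).im| * ‖((g : Matrix (Fin N) (Fin N) ℂ) * Δ).trace‖
              + frobNorm Δ * |(((g : Matrix (Fin N) (Fin N) ℂ) * B).trace - m₁).im| * ‖((g : Matrix (Fin N) (Fin N) ℂ) * B).trace‖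
              + frobNorm B * ‖((g : Matrix (Fin N) (Fin N) ℂ) * B).trace‖ * ‖((g : Matrix (Fin N) (Fin N) ℂ) * Δ).trace‖)) := by
      positivity
    simp only [hfb, hfc, hfd, hfe]
    calc _ ≤ _ := hP
      _ ≤ (a + b₁ * ‖((g : Matrix (Fin N) (Fin N) ℂ) * B).trace - m₁‖ + b₂ * ‖((g : Matrix (Fin N) (Fin N) ℂ) * Δ).trace - m₂‖
            + b₃ * ‖((g : Matrix (Fin N) (Fin N) ℂ) * Δ * (g : Matrix (Fin N) (Fin N) ℂ) * B).trace‖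
            + b₄ * ‖((g : Matrix (Fin N) (Fin N) ℂ) * B * (g : Matrix (Fin N) (Fin N) ℂ) * B).trace‖) ^ 2 := by
          refine pow_le_pow_left₀ hP0 ?_ 2
          rw [ha, hb₁, hb₂, hb₃, hb₄]
          exact haff

end Summit.Ventures.YMGap.OneLinkEigen
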